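/-
K-task «TOWER», PART E (cell rh-split, lead RULINGS #354 (b) / #359 (b); spec rh-idea-5 g2 23:32:21Z word (1),
23:38:50Z correction, 23:39:38Z erratum, `TowerSketch.lean` v5; referee rh-split-ref-2 g7 23:48:37Z (i)–(iv);
barrier candidate B26 «TOWER BARRIER»).  Model file: part D's blind model with weight-adapted aliases, a
MULTIPLICITY BAND and the THIN ORDINATE COUNT.  Nothing here bears on the truth of RH.
-/
import Summits.RiemannHypothesis.RiemannHypothesis.Theorems.Splittings.ScrewLatticeWolffModel
import Summits.RiemannHypothesis.RiemannHypothesis.Theorems.Splittings.ScrewLatticeTowerE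
import Summits.RiemannHypothesis.RiemannHypothesis.Theorems.Splittings.ScrewLatticeTowerBand
import Mathlib.Analysis.SpecialFunctions.Complex.Arg
import Mathlib.Analysis.SpecialFunctions.Log.Basic
import Mathlib.Analysis.SpecialFunctions.Pow.Real
import HarnessLib

/-!
# The rigid polygon TOWER as a THIN blind model (B26 kernel form: B16-bis ∧ E1 ∧ E2)

`ScrewLatticeTower.exists_tower_blind_model` (part D) re-proves the eleven clauses of B16′
(`ScrewLatticeWolffOneCircle.exists_blind_model_discrete`) on the polygon tower; those clauses see the
configuration only through the atoms `w = e^{κ h}` and the weights `α`, so the ordinates `Im κ` are free aliases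
and any count `#{Im κ ≤ T} ≤ C T^e` ALONE is vacuous (spread the aliases).  Content enters with a MULTIPLICITY
BAND (E1): after ONE global scale `λ`, every multiplicity lies in `[1, B]`.  The tuning identity
`m₁/κ₁² + m₂/κ̄₂² = -λ α` then pins `γ² ≍ m/(λ α)`, so under (E1) the ordinate count IS the tower's weight count
`#{i : α_i ≳ 1/T²}`, and part E's thin weights (`ScrewLatticeTowerE.exists_towerData_thin`: `α_i ℓ_i^{β+1} ≤ E`,
`#{ℓ ≤ L} ≤ K + (L+1)²`) give (E2): `#{i : Im κ₁ i ≤ T ∨ Im κ₂ i ≤ T} ≤ C T^e` for every `T ≥ 1`, for EVERY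
prescribed `e > 0` at depth `c ≤ 1/(⌈4/e⌉ + 3)`.  THEOREM `exists_tower_thin_blind_model`: for every `h > 0`,
`σ* > 0`, `e > 0` and `0 < c ≤ 1/(⌈4/e⌉₊ + 3)` a configuration with part D's eleven clauses VERBATIM, (E1) and
(E2).  Ingredients: weight-adapted aliases `N_i = N₀ + ⌈α_i^{-1/2}⌉` (so `α_i γ_i² ∈ [4π²/h², U²]`), the tuning
lemma with a two-sided bound (`ScrewLatticeTowerBand.exists_tuning_band`, `λ α γ²/3 ≤ m ≤ 3 λ α γ²`), B16's
lattice theorems by name.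
ζ-free, RH-free; std axioms.  Nothing here bears on the truth of RH.
-/

noncomputable section

set_option linter.dupNamespace false

open Complex Set Filter Topology
open scoped ComplexConjugate Real

namespace Summit.RiemannHypothesis.RiemannHypothesis.Theorems.Splittings.ScrewLatticeTower

open Summit.RiemannHypothesis.RiemannHypothesis.Theorems.Splittings.ScrewLatticeWolff
open Summit.RiemannHypothesis.RiemannHypothesis.Theorems.Splittings.ScrewLatticeWolffModel

/-! ## 17. The thin blind model -/

/-- **B26, kernel form (rigid polygon TOWER: B16-bis ∧ MULTIPLICITY BAND ∧ THIN COUNT).**  For every `h > 0`,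
`σ* > 0`, every `e > 0` and every depth `0 < c ≤ 1/(⌈4/e⌉₊ + 3)` there is a positive-real-weight configuration
of zero quadruples satisfying, VERBATIM, the eleven clauses of part D / B16′
(`ScrewLatticeTower.exists_tower_blind_model`, `ScrewLatticeWolffOneCircle.exists_blind_model_discrete`:
abscissae in `(0, σ*)`, ordinates `> 14` and locally finite, `Σ m/γ² < ∞`, unattained supremum of abscissae,
uniform positive floor and ceiling and `LPSD(h)` for the model screw function on the lattice `hℕ`, abscissae
discrete below `σ*`), AND (E1) a MULTIPLICITY BAND after one global scale — `1 ≤ m₁ i ≤ B` and `1 ≤ m₂ i ≤ B`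
for every `i` — AND (E2) the THIN ORDINATE COUNT for the union of both ordinate families: for every `T ≥ 1` the
indices with `Im κ₁ i ≤ T` or `Im κ₂ i ≤ T` lie in a finite set of cardinality `≤ C T^e` (`C` independent of
`T`).  Built on the tower data of `ScrewLatticeTowerE.exists_towerData_thin` (exponent `β = ⌈4/e⌉₊`) with the
weight-adapted aliases `N_i = N₀ + ⌈α_i^{-1/2}⌉₊` and the scale `λ = 3h²/(4π²)`.  HONEST LABEL: a blind model is
an obstruction statement about lattice screw criteria (here: against conjuncts that COUNT ordinates up to `T^e`,
read densities or multiplicities), RH-free; nothing here bears on the truth of RH. -/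
theorem exists_tower_thin_blind_model {h σs c e : ℝ} (hh : 0 < h) (hσs : 0 < σs) (hc : 0 < c)
    (he : 0 < e) (hce : c ≤ 1 / ((⌈4 / e⌉₊ : ℕ) + 3 : ℝ)) :
    ∃ (ι : Type) (m₁ m₂ : ι → ℝ) (κ₁ κ₂ : ι → ℂ),
      Nonempty ι ∧
      (∀ i, 0 < m₁ i ∧ 0 < m₂ i) ∧
      (∀ i, 0 < (κ₁ i).re ∧ (κ₁ i).re < σs ∧ (κ₂ i).re = (κ₁ i).re) ∧
      (∀ i, 14 < (κ₁ i).im ∧ 14 < (κ₂ i).im) ∧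
      (∀ T : ℝ, {i | (κ₁ i).im ≤ T}.Finite ∧ {i | (κ₂ i).im ≤ T}.Finite) ∧
      Summable (fun i ↦ m₁ i / (κ₁ i).im ^ 2 + m₂ i / (κ₂ i).im ^ 2) ∧
      (∀ i, ∃ j, (κ₁ i).re < (κ₁ j).re) ∧
      (∃ A : ℝ, 0 < A ∧ ∀ k : ℕ, 1 ≤ k →
          2 * A ≤ modelPsi m₁ m₂ κ₁ κ₂ (k * h) ∧ modelPsi m₁ m₂ κ₁ κ₂ (k * h) ≤ 6 * A) ∧
      (∀ (N : ℕ) (t x : Fin N → ℝ), (∀ a, t a ∈ Set.range fun k : ℕ ↦ (k : ℝ) * h) →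
          0 ≤ ∑ a, ∑ b, (modelPsi m₁ m₂ κ₁ κ₂ (t a) + modelPsi m₁ m₂ κ₁ κ₂ (t b)
            - modelPsi m₁ m₂ κ₁ κ₂ (t a - t b)) * (x a * x b)) ∧
      (∀ σ < σs, {i | (κ₁ i).re ≤ σ}.Finite) ∧
      (∃ B : ℝ, ∀ i, 1 ≤ m₁ i ∧ m₁ i ≤ B ∧ 1 ≤ m₂ i ∧ m₂ i ≤ B) ∧
      (∃ C : ℝ, ∀ T : ℝ, 1 ≤ T → ∃ s : Finset ι,
          (∀ i, (κ₁ i).im ≤ T ∨ (κ₂ i).im ≤ T → i ∈ s) ∧ (s.card : ℝ) ≤ C * T ^ e) := by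
  have hh0 : h ≠ 0 := hh.ne'
  have hπ := Real.pi_pos
  -- exponent and depth
  set β : ℕ := ⌈4 / e⌉₊ with hβ_def
  have hβe : 4 / e ≤ (β : ℝ) := Nat.le_ceil _
  obtain ⟨hx, hy⟩ := depth_hyps hc β (by simpa using hce)
  -- thin tower data in the annulus `1 < |w| < e^{σ* h}`
  have hR : 1 < Real.exp (σs * h) := Real.one_lt_exp_iff.mpr (by positivity)
  obtain ⟨ι, -, w, α, ℓ, K, E, hne, hann, hα0, hαs, hW, hsup, hdisc, hthin, hcount⟩ :=
    exists_towerData_thin hR hc hx β hy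
  -- the weights are bounded: `√(α i) ≤ S`
  have hαle : ∀ i, α i ≤ ∑' j, α j := fun i ↦ hαs.le_tsum i (fun j _ ↦ (hα0 j).le)
  set S : ℝ := max 1 (∑' j, α j) with hS_def
  have hS1 : 1 ≤ S := le_max_left _ _
  have hsq0 : ∀ i, 0 < Real.sqrt (α i) := fun i ↦ Real.sqrt_pos.mpr (hα0 i)
  have hsq2 : ∀ i, Real.sqrt (α i) ^ 2 = α i := fun i ↦ Real.sq_sqrt (hα0 i).le
  have hsqS : ∀ i, Real.sqrt (α i) ≤ S := by
    intro i
    rcases le_or_gt (α i) 1 with h1 | h1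
    · calc Real.sqrt (α i) ≤ Real.sqrt 1 := Real.sqrt_le_sqrt h1
        _ = 1 := Real.sqrt_one
        _ ≤ S := hS1
    · have h2 : Real.sqrt (α i) ≤ α i :=
        calc Real.sqrt (α i) ≤ Real.sqrt (α i ^ 2) := Real.sqrt_le_sqrt (by nlinarith)
          _ = α i := Real.sqrt_sq (hα0 i).le
      exact h2.trans ((hαle i).trans (le_max_right _ _))
  -- weight-adapted aliases `N_i = N₀ + ⌈α_i^{-1/2}⌉`
  set N₀ : ℕ := ⌈(14 * h + 2 * σs * h + π) / (2 * π)⌉₊ + 1 with hN₀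
  have hN₀ge : (14 * h + 2 * σs * h + π) / (2 * π) + 1 ≤ (N₀ : ℝ) := by
    rw [hN₀]; push_cast; linarith [Nat.le_ceil ((14 * h + 2 * σs * h + π) / (2 * π))]
  have hN₀2 : (2 : ℝ) ≤ N₀ := by
    have hpos : 0 < (14 * h + 2 * σs * h + π) / (2 * π) := by positivity
    have h1 : 1 ≤ ⌈(14 * h + 2 * σs * h + π) / (2 * π)⌉₊ := Nat.one_le_iff_ne_zero.mpr
      (by rw [Ne, Nat.ceil_eq_zero]; linarith)
    rw [hN₀]; push_cast
    have : (1 : ℝ) ≤ (⌈(14 * h + 2 * σs * h + π) / (2 * π)⌉₊ : ℝ) := by exact_mod_cast h1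
    linarith
  set Nf : ι → ℕ := fun i ↦ N₀ + ⌈1 / Real.sqrt (α i)⌉₊ with hNf
  have hNfge : ∀ i, (N₀ : ℝ) + 1 / Real.sqrt (α i) ≤ (Nf i : ℕ) := by
    intro i; rw [hNf]; push_cast; linarith [Nat.le_ceil (1 / Real.sqrt (α i))]
  have hNfle : ∀ i, ((Nf i : ℕ) : ℝ) ≤ N₀ + 1 / Real.sqrt (α i) + 1 := by
    intro i; rw [hNf]; push_cast
    linarith [(Nat.ceil_lt_add_one (by positivity : (0 : ℝ) ≤ 1 / Real.sqrt (α i))).le]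
  have hwin : ∀ i, 2 * π / (h * Real.sqrt (α i)) ≤ (2 * π * (Nf i : ℕ) - π) / h ∧
      (2 * π * (Nf i : ℕ) + π) / h ≤ 2 * ((2 * π * (Nf i : ℕ) - π) / h) ∧
      Real.sqrt (α i) * ((2 * π * (Nf i : ℕ) + π) / h) ≤ (2 * π + (2 * N₀ + 3) * π * Real.sqrt (α i)) / h :=
    fun i ↦ alias_window hh (hsq0 i) hN₀2 (hNfge i) (hNfle i)
  -- the data
  set σ : ι → ℝ := fun i ↦ Real.log ‖w i‖ / h with hσ_def
  set γ₁ : ι → ℝ := fun i ↦ (arg (w i) + 2 * π * (Nf i : ℕ)) / h with hγ₁_def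
  set γ₂ : ι → ℝ := fun i ↦ (2 * π * (Nf i : ℕ) - arg (w i)) / h with hγ₂_def
  set κ₁ : ι → ℂ := fun i ↦ ((σ i : ℝ) : ℂ) + ((γ₁ i : ℝ) : ℂ) * I with hκ₁_def
  set κ₂ : ι → ℂ := fun i ↦ ((σ i : ℝ) : ℂ) + ((γ₂ i : ℝ) : ℂ) * I with hκ₂_def
  -- elementary facts
  have hw0 : ∀ i, w i ≠ 0 := fun i ↦ by
    intro h0; have := (hann i).1; rw [h0, norm_zero] at this; linarith
  have hσpos : ∀ i, 0 < σ i := fun i ↦ div_pos (Real.log_pos (hann i).1) hh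
  have hσlt : ∀ i, σ i < σs := fun i ↦ by
    rw [hσ_def]
    simp only
    rw [div_lt_iff₀ hh]
    exact (Real.log_lt_iff_lt_exp (norm_pos_iff.mpr (hw0 i))).mpr (hann i).2
  have hNlow : ∀ i, 14 * h + 2 * σs * h + π ≤ 2 * π * (Nf i : ℕ) - 2 * π := by
    intro i
    have h1 : (N₀ : ℝ) ≤ (Nf i : ℕ) := by
      have : 0 ≤ 1 / Real.sqrt (α i) := by positivity
      linarith [hNfge i]
    have h2 : (14 * h + 2 * σs * h + π) / (2 * π) ≤ (Nf i : ℕ) - 1 := by linarith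
    rw [div_le_iff₀ (by positivity)] at h2
    linarith
  have hγ₁low : ∀ i, 14 + 2 * σs < γ₁ i := by
    intro i
    rw [hγ₁_def]; simp only; rw [lt_div_iff₀ hh]
    linarith [hNlow i, Complex.neg_pi_lt_arg (w i), Real.pi_pos]
  have hγ₂low : ∀ i, 14 + 2 * σs < γ₂ i := by
    intro i
    rw [hγ₂_def]; simp only; rw [lt_div_iff₀ hh]
    linarith [hNlow i, Complex.arg_le_pi (w i), Real.pi_pos]
  -- both ordinates lie in the alias window `[(2π N_i - π)/h, (2π N_i + π)/h]`
  have hγ₁lo : ∀ i, (2 * π * (Nf i : ℕ) - π) / h ≤ γ₁ i := fun i ↦ by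
    rw [hγ₁_def]; simp only
    exact div_le_div_of_nonneg_right (by linarith [Complex.neg_pi_lt_arg (w i)]) hh.le
  have hγ₂lo : ∀ i, (2 * π * (Nf i : ℕ) - π) / h ≤ γ₂ i := fun i ↦ by
    rw [hγ₂_def]; simp only
    exact div_le_div_of_nonneg_right (by linarith [Complex.arg_le_pi (w i)]) hh.le
  have hγ₁hi : ∀ i, γ₁ i ≤ (2 * π * (Nf i : ℕ) + π) / h := fun i ↦ by
    rw [hγ₁_def]; simp only
    exact div_le_div_of_nonneg_right (by linarith [Complex.arg_le_pi (w i)]) hh.le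
  have hγ₂hi : ∀ i, γ₂ i ≤ (2 * π * (Nf i : ℕ) + π) / h := fun i ↦ by
    rw [hγ₂_def]; simp only
    exact div_le_div_of_nonneg_right (by linarith [Complex.neg_pi_lt_arg (w i)]) hh.le
  -- the weight controls the ordinate: `4π²/h² ≤ α γ² ≤ U²` on the window
  set U : ℝ := (2 * π + (2 * N₀ + 3) * π * S) / h with hU
  have hlow_sq : ∀ (i) (γ : ℝ), (2 * π * (Nf i : ℕ) - π) / h ≤ γ → 4 * π ^ 2 / h ^ 2 ≤ α i * γ ^ 2 := by
    intro i γ hγ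
    have := sq_window_lower hh (hsq0 i) ((hwin i).1.trans hγ)
    rwa [hsq2 i] at this
  have hup_sq : ∀ (i) (γ : ℝ), 0 ≤ γ → γ ≤ (2 * π * (Nf i : ℕ) + π) / h → α i * γ ^ 2 ≤ U ^ 2 := by
    intro i γ hγ0 hγ
    have h1 : Real.sqrt (α i) * γ ≤ U := by
      refine (mul_le_mul_of_nonneg_left hγ (hsq0 i).le).trans ((hwin i).2.2.trans ?_)
      rw [hU]
      apply div_le_div_of_nonneg_right _ hh.le
      have : (2 * N₀ + 3) * π * Real.sqrt (α i) ≤ (2 * N₀ + 3) * π * S :=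
        mul_le_mul_of_nonneg_left (hsqS i) (by positivity)
      linarith
    have h2 := pow_le_pow_left₀ (by positivity) h1 2
    rw [mul_pow, hsq2 i] at h2
    exact h2
  -- tuning with the ONE global scale `λ = 3h²/(4π²)`
  set lam : ℝ := 3 * h ^ 2 / (4 * π ^ 2) with hlam
  have hlam0 : 0 < lam := by positivity
  have hlam3 : lam * (4 * π ^ 2 / h ^ 2) = 3 := by rw [hlam]; field_simp
  have htun : ∀ i, ∃ m₁ m₂ : ℝ, 0 < m₁ ∧ 0 < m₂ ∧
      (m₁ : ℂ) / ((σ i : ℂ) + γ₁ i * I) ^ 2 + (m₂ : ℂ) / (conj ((σ i : ℂ) + γ₂ i * I)) ^ 2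
        = -((lam * α i : ℝ) : ℂ) ∧
      m₁ / γ₁ i ^ 2 ≤ 3 * (lam * α i) ∧ m₂ / γ₂ i ^ 2 ≤ 3 * (lam * α i) ∧
      lam * α i * γ₁ i ^ 2 ≤ 3 * m₁ ∧ lam * α i * γ₂ i ^ 2 ≤ 3 * m₂ := fun i ↦
    exists_tuning_band (hσpos i) (by linarith [hσlt i, hγ₁low i]) (by linarith [hσlt i, hγ₂low i])
      ((hγ₂hi i).trans ((hwin i).2.1.trans (by linarith [hγ₁lo i])))
      ((hγ₁hi i).trans ((hwin i).2.1.trans (by linarith [hγ₂lo i])))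
      (mul_pos hlam0 (hα0 i))
  choose m₁ m₂ hm₁ hm₂ htune hb₁ hb₂ hl₁ hl₂ using htun
  -- hypotheses of the model theorems
  have hw₁ : ∀ i, Complex.exp (κ₁ i * h) = w i := fun i ↦ exp_kappa₁ (hw0 i) hh0 (Nf i)
  have hw₂ : ∀ i, Complex.exp (κ₂ i * h) = conj (w i) := fun i ↦ exp_kappa₂ (hw0 i) hh0 (Nf i)
  have htune' : ∀ i, (m₁ i : ℂ) / κ₁ i ^ 2 + (m₂ i : ℂ) / (conj (κ₂ i)) ^ 2
      = -(((lam * α i : ℝ)) : ℂ) := fun i ↦ htune i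
  have hα0' : ∀ i, 0 ≤ α i := fun i ↦ (hα0 i).le
  have hw1 : ∀ i, 1 ≤ ‖w i‖ := fun i ↦ (hann i).1.le
  -- (E2) the count at every height `T ≥ 1`: `γ ≤ T ⇒ α ≥ 4π²/(h²T²) ⇒ ℓ ≤ L(T)`, then `count_algebra`
  have ha₀ : 0 < 4 * π ^ 2 / h ^ 2 := by positivity
  have hD0 : 0 ≤ E / (4 * π ^ 2 / h ^ 2) := by
    obtain ⟨i₀⟩ := hne
    have hE0 : 0 ≤ E := le_trans (by have := hα0 i₀; positivity) (hthin i₀)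
    positivity
  have hcountT : ∀ T : ℝ, 1 ≤ T → ∃ s : Finset ι, (∀ i, γ₁ i ≤ T ∨ γ₂ i ≤ T → i ∈ s) ∧
      (s.card : ℝ) ≤ (K + ((E / (4 * π ^ 2 / h ^ 2)) ^ ((β + 1 : ℕ) : ℝ)⁻¹ + 1) ^ 2) * T ^ e := by
    intro T hT
    obtain ⟨s, hs, hcard⟩ := hcount ⌊(E / (4 * π ^ 2 / h ^ 2) * T ^ 2) ^ ((β + 1 : ℕ) : ℝ)⁻¹⌋₊
    refine ⟨s, fun i hi ↦ hs i (nat_le_floor_rpow ha₀ (hthin i) ?_),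
      count_algebra hD0 hT he hβe (Nat.floor_le (by positivity)) hcard⟩
    rcases hi with hi | hi
    · have h1 := hlow_sq i (γ₁ i) (hγ₁lo i)
      have h0 : 0 ≤ γ₁ i := by linarith [hγ₁low i]
      have h2 := mul_le_mul_of_nonneg_left (pow_le_pow_left₀ h0 hi 2) (hα0' i)
      exact h1.trans h2
    · have h1 := hlow_sq i (γ₂ i) (hγ₂lo i)
      have h0 : 0 ≤ γ₂ i := by linarith [hγ₂low i]
      have h2 := mul_le_mul_of_nonneg_left (pow_le_pow_left₀ h0 hi 2) (hα0' i)
      exact h1.trans h2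
  -- assemble: the eleven clauses of part D verbatim, then (E1), (E2)
  refine ⟨ι, m₁, m₂, κ₁, κ₂, hne, fun i ↦ ⟨hm₁ i, hm₂ i⟩, ?_, ?_, ?_, ?_, ?_, ?_, ?_, ?_, ?_, ?_⟩
  · intro i
    refine ⟨?_, ?_, ?_⟩
    · simpa [hκ₁_def] using hσpos i
    · simpa [hκ₁_def] using hσlt i
    · simp [hκ₁_def, hκ₂_def]
  · intro i
    constructor
    · simpa [hκ₁_def] using (by linarith [hγ₁low i] : 14 < γ₁ i)
    · simpa [hκ₂_def] using (by linarith [hγ₂low i] : 14 < γ₂ i)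
  · -- local finiteness, from the count at height `max T 1`
    intro T
    obtain ⟨s, hs, -⟩ := hcountT (max T 1) (le_max_right _ _)
    constructor
    · refine s.finite_toSet.subset fun i hi ↦ ?_
      have hi' : γ₁ i ≤ T := by simpa [hκ₁_def] using hi
      exact hs i (Or.inl (hi'.trans (le_max_left _ _)))
    · refine s.finite_toSet.subset fun i hi ↦ ?_
      have hi' : γ₂ i ≤ T := by simpa [hκ₂_def] using hi
      exact hs i (Or.inr (hi'.trans (le_max_left _ _)))
  · -- Σ m/γ² ≤ 6 λ Σ α
    have hs6 : Summable (fun i ↦ 6 * (lam * α i)) := (hαs.mul_left lam).mul_left 6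
    refine Summable.of_nonneg_of_le (fun i ↦ ?_) (fun i ↦ ?_) hs6
    · have := hm₁ i; have := hm₂ i
      simp only [hκ₁_def, hκ₂_def, Complex.add_im, Complex.ofReal_im, Complex.mul_im, Complex.ofReal_re,
        Complex.I_im, Complex.I_re, mul_one, mul_zero, zero_add, add_zero]
      positivity
    · simp only [hκ₁_def, hκ₂_def, Complex.add_im, Complex.ofReal_im, Complex.mul_im, Complex.ofReal_re,
        Complex.I_im, Complex.I_re, mul_one, mul_zero, zero_add, add_zero]
      linarith [hb₁ i, hb₂ i]
  · -- sup not attained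
    intro i
    obtain ⟨j, hlt⟩ := hsup i
    refine ⟨j, ?_⟩
    simp only [hκ₁_def, Complex.add_re, Complex.ofReal_re, Complex.mul_re, Complex.I_re, Complex.I_im,
      Complex.ofReal_im, mul_zero, mul_one, sub_zero, add_zero, hσ_def]
    exact div_lt_div_of_pos_right (Real.log_lt_log (norm_pos_iff.mpr (hw0 i)) hlt) hh
  · -- floor and ceiling with A = λ Σ α > 0
    refine ⟨lam * ∑' i, α i, ?_, fun k hk ↦ ⟨?_, ?_⟩⟩
    · obtain ⟨i₀⟩ := hne
      exact mul_pos hlam0 (hαs.tsum_pos hα0' i₀ (hα0 i₀))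
    · have := modelPsi_lattice_floor hw₁ hw₂ htune' hαs hα0' hw1 hlam0.le hW hk
      simpa [mul_assoc] using this
    · have := modelPsi_lattice_ceiling hw₁ hw₂ htune' hαs hα0' hw1 hlam0.le hW hk
      simpa [mul_assoc] using this
  · intro N t' x ht'
    exact modelPsi_latticePSD hw₁ hw₂ htune' hαs hα0' hw1 hlam0.le hW t' x ht'
  · -- discreteness of the abscissae below `σ*`
    intro σ' hσ'
    have hρ : Real.exp (σ' * h) < Real.exp (σs * h) := Real.exp_lt_exp.mpr (by nlinarith)
    refine (hdisc (Real.exp (σ' * h)) hρ).subset fun i hi ↦ ?_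
    simp only [Set.mem_setOf_eq] at hi ⊢
    have hi' : Real.log ‖w i‖ / h ≤ σ' := by
      simpa only [hκ₁_def, Complex.add_re, Complex.ofReal_re, Complex.mul_re, Complex.I_re, Complex.I_im,
        Complex.ofReal_im, mul_zero, mul_one, sub_zero, add_zero, hσ_def] using hi
    rw [div_le_iff₀ hh] at hi'
    exact (Real.log_le_iff_le_exp (norm_pos_iff.mpr (hw0 i))).mp hi'
  · -- (E1) the multiplicity band `1 ≤ m ≤ B`, `B = 3 λ U²`, after the one scale `λ`
    refine ⟨3 * lam * U ^ 2, fun i ↦ ⟨?_, ?_, ?_, ?_⟩⟩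
    · have h1 := mul_le_mul_of_nonneg_left (hlow_sq i (γ₁ i) (hγ₁lo i)) hlam0.le
      rw [hlam3] at h1
      linarith [hl₁ i]
    · have h1 := mul_le_mul_of_nonneg_left (hup_sq i (γ₁ i) (by linarith [hγ₁low i]) (hγ₁hi i)) hlam0.le
      have h2 := hb₁ i
      have hγpos : 0 < γ₁ i := by linarith [hγ₁low i]
      have hγ0 : 0 < γ₁ i ^ 2 := by positivity
      rw [div_le_iff₀ hγ0] at h2
      linarith
    · have h1 := mul_le_mul_of_nonneg_left (hlow_sq i (γ₂ i) (hγ₂lo i)) hlam0.le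
      rw [hlam3] at h1
      linarith [hl₂ i]
    · have h1 := mul_le_mul_of_nonneg_left (hup_sq i (γ₂ i) (by linarith [hγ₂low i]) (hγ₂hi i)) hlam0.le
      have h2 := hb₂ i
      have hγpos : 0 < γ₂ i := by linarith [hγ₂low i]
      have hγ0 : 0 < γ₂ i ^ 2 := by positivity
      rw [div_le_iff₀ hγ0] at h2
      linarith
  · -- (E2) the thin ordinate count for the union of both families
    refine ⟨K + ((E / (4 * π ^ 2 / h ^ 2)) ^ ((β + 1 : ℕ) : ℝ)⁻¹ + 1) ^ 2, fun T hT ↦ ?_⟩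
    obtain ⟨s, hs, hcard⟩ := hcountT T hT
    refine ⟨s, fun i hi ↦ hs i ?_, hcard⟩
    simpa [hκ₁_def, hκ₂_def] using hi

/-- **Non-vacuity instance** (referee (iv)): exponent `e = 1` at depth `c = 1/7 = 1/(⌈4/1⌉₊ + 3)`, step
`h = 1`, `σ* = 1` — the hypotheses of `exists_tower_thin_blind_model` are met by numerals. -/
theorem exists_tower_thin_blind_model_one :
    ∃ (ι : Type) (m₁ m₂ : ι → ℝ) (κ₁ κ₂ : ι → ℂ),
      Nonempty ι ∧
      (∀ i, 0 < m₁ i ∧ 0 < m₂ i) ∧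
      (∀ i, 0 < (κ₁ i).re ∧ (κ₁ i).re < 1 ∧ (κ₂ i).re = (κ₁ i).re) ∧
      (∀ i, 14 < (κ₁ i).im ∧ 14 < (κ₂ i).im) ∧
      (∀ T : ℝ, {i | (κ₁ i).im ≤ T}.Finite ∧ {i | (κ₂ i).im ≤ T}.Finite) ∧
      Summable (fun i ↦ m₁ i / (κ₁ i).im ^ 2 + m₂ i / (κ₂ i).im ^ 2) ∧
      (∀ i, ∃ j, (κ₁ i).re < (κ₁ j).re) ∧
      (∃ A : ℝ, 0 < A ∧ ∀ k : ℕ, 1 ≤ k →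
          2 * A ≤ modelPsi m₁ m₂ κ₁ κ₂ (k * 1) ∧ modelPsi m₁ m₂ κ₁ κ₂ (k * 1) ≤ 6 * A) ∧
      (∀ (N : ℕ) (t x : Fin N → ℝ), (∀ a, t a ∈ Set.range fun k : ℕ ↦ (k : ℝ) * 1) →
          0 ≤ ∑ a, ∑ b, (modelPsi m₁ m₂ κ₁ κ₂ (t a) + modelPsi m₁ m₂ κ₁ κ₂ (t b)
            - modelPsi m₁ m₂ κ₁ κ₂ (t a - t b)) * (x a * x b)) ∧
      (∀ σ < (1 : ℝ), {i | (κ₁ i).re ≤ σ}.Finite) ∧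
      (∃ B : ℝ, ∀ i, 1 ≤ m₁ i ∧ m₁ i ≤ B ∧ 1 ≤ m₂ i ∧ m₂ i ≤ B) ∧
      (∃ C : ℝ, ∀ T : ℝ, 1 ≤ T → ∃ s : Finset ι,
          (∀ i, (κ₁ i).im ≤ T ∨ (κ₂ i).im ≤ T → i ∈ s) ∧ (s.card : ℝ) ≤ C * T ^ (1 : ℝ)) :=
  exists_tower_thin_blind_model (h := 1) (σs := 1) (c := 1 / 7) (e := 1) one_pos one_pos (by norm_num)
    one_pos (by norm_num)

end Summit.RiemannHypothesis.RiemannHypothesis.Theorems.Splittings.ScrewLatticeTower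

end
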